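/-
Copyright (c) 2026 the pub-hodgecm-mathlib formalisation cell (harness21).  Prover seat hodgecm-mathlib-K2E4-p21 (g0) (outside hand on the E3 WILD CHAIN, K2E3-plan (g1) DEALS BATCH #2
22:15:20Z; line lead K2E3-p17 (g0) asked 22:19:55Z «valencies-WILD?»): brick T1e «VALENCIES», WILD EDITION = ★ `UnitaryLatticeTreeValencyRamified` re-lettered at the ramified quadratic
datum (tame letters `hσϖ hres h2 hnorm` ↦ `heven hd h1d h2t`), tree-ness DISCHARGED.  2026-09-03.
-/
import Literature.NumberTheory.Automorphic.UnitaryLatticeTreeRootStarCountWild     -- ★ (LH4-p01): `ncard_neighborSet_of_isSelfDualLattice_wild` (`q + 1` at a self-dual vertex, any ramified place); brings ★ TypeTwoStarCountWild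
import Literature.NumberTheory.Automorphic.UnitaryLatticeTreeEulerRelationWild      -- ★ `isTree_latticeGraph_three_of_ramified` (the WILD tree; discharges the tame file's binder `hT`)
import Literature.NumberTheory.Automorphic.UnitaryLatticeTreeValencyRamified        -- ★ T1e R4 (B-p14 (g36)): the TAME edition; datum-free §1 `isVertexLattice_two_of_not_isSelfDualLattice_of_v`, `typeFun_ne_of_adj_of_v`; brings `exists_typeFun`, `TreeDisplacement.ncard_sphere_eq_of_biregular'`
import HarnessLib

/-!
# The lattice graph of a hermitian space — T1e FILE R4-W: THE `U(3)` LATTICE GRAPH IS `(q+1)`-REGULAR AND ITS SPHERES HAVE `(q+1)·q^{m−1}` VERTICES AT EVERY RAMIFIED PLACE, WILD ONES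
# INCLUDED (Tits 1979 §2.4; Serre, *Trees* II.1.1)

Topic `NumberTheory/Automorphic`; namespace `Literature.NumberTheory.Automorphic.UnitaryLatticeTree`.  THEOREMS ONLY (no definition, no instance, no notation, no named fact, no `sorry`);
kernel lane `--supports stmt-HodgeConjecture-24833 --as helper`.  Cell `pub/hodgecm-mathlib` (D-0151), crux H413 = `stmt-HodgeConjecture-24833`; Track B «K2-LIT», the E3 WILD CHAIN
(K2E3-plan (g1) DEALS BATCH #2, line lead K2E3-p17 (g0): «H-RAM's tame calls are `isTree∕htr₂` (★ wild), `ncard_sphere_of_neg` (★ valencies-WILD?) …»), outside hand K2E4-p21 (g0).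

THE SETTING (the cell's «ramified quadratic datum», ★ `IsRamifiedQuadraticDatum σ ϖ d t`, NO parity ∕ tameness condition): `σ` an isometric involution of `K`, `|ϖ| = q⁻¹`, the non-zero
`σ`-fixed elements have EVEN valuation (`heven`), `|ϖ − σϖ| = |ϖ|^d` with `d ≥ 1` (`hd h1d`), `|2| = |ϖ|^t` (`h2t`) — the tame case is `t = 0`, the WILD (dyadic) case `t ≥ 1`.  ★ WILD
inputs: every self-dual vertex has `q + 1` neighbours (★ `ncard_neighborSet_of_isSelfDualLattice_wild`, the root star at the datum), every type-two vertex has `q + 1` neighbours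
(★ `ncard_neighborSet_of_isVertexLattice_two_wild`, residual triviality from `heven` by ★ `v_map_sub_self_lt_one_of_even`, `2 ≠ 0` from `h2t`), and the graph IS A TREE (★
`isTree_latticeGraph_three_of_ramified`).  THIS FILE is ★ R4 `UnitaryLatticeTreeValencyRamified` §2–§3 VERBATIM with the tame letters `hσϖ hres h2 hnorm` replaced by the datum's
`heven hd h1d h2t` — and with R4's tree BINDER `hT` DISCHARGED (at a ramified place R4 carried tree-ness as a hypothesis; the wild tree is ★ now):

* §1 **`ncard_neighborSet_wild : #star(v) = q + 1` for EVERY vertex** (the graph is `(q+1)`-REGULAR — local index `(q+1, q+1)` of the ramified quasi-split `U(3)`, both vertices special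
  [Tits1979, §2.4]); `finite_neighborSet_wild` (`hnb`, from the positive count); `ncard_neighborSet_eq_typeFun_wild` (the `hdeg` plug with `q := (q, q)`).
* §2 **`ncard_sphere_wild (r) (hm : 1 ≤ m) : #{v | dist(r,v) = m} = (q + 1) · q^{m−1}`** for EVERY vertex `r`, hypothesis-free beyond the datum (★ `TreeDisplacement.ncard_sphere_eq_of_biregular'`
  with the constant valency vector `(q, q)` and `⌊m∕2⌋ + ⌊(m−1)∕2⌋ = m − 1`); `ncard_sphere_two_wild : #S₂(r) = q² + q`.
* §3 DATUM-FORM HEADS (the shape of ★ `ncard_neighborSet_of_isSelfDualLattice_of_isRamifiedQuadraticDatum`): `ncard_neighborSet_of_isRamifiedQuadraticDatum`, `ncard_sphere_of_isRamifiedQuadraticDatum`.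

HONEST LABEL: HC_CM is proved only modulo the 7 printed citations (2 remaining named inputs hLiu418 = `stmt-HodgeConjecture-24832`, h413 = `stmt-HodgeConjecture-24833`) until rung 0
closes; nothing printed is asserted here; count-neutral brick of the E3 wild chain (H-W `K2E3CharacterEllipticUniformWild` consumes the sphere counts).

## References
* [Tits1979] J. Tits, *Reductive groups over local fields*, PSPM 33.1 (1979), §2.4 (ramified quasi-split `U(3)`: both vertices special, local index `(q+1, q+1)`), §2.7 p. 48, §3.5.
* [BruhatTits1972] F. Bruhat, J. Tits, *Groupes réductifs sur un corps local I*, Publ. Math. IHÉS 41 (1972), §10.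
* [Serre1980Trees] J.-P. Serre, *Trees* (1980), Ch. II §1.1; Ch. I §2.3 (spheres of a regular tree).
* [Jacobowitz1962] R. Jacobowitz, *Hermitian forms over local fields*, Amer. J. Math. 84 (1962), §§7–11 (the dyadic case).
-/

set_option autoImplicit false

noncomputable section

open scoped Valued WithZero Matrix MatrixGroups

namespace Literature.NumberTheory.Automorphic.UnitaryLatticeTree

open Literature.NumberTheory.Automorphic Literature.NumberTheory.Automorphic.HermitianLattice
open Literature.NumberTheory.Automorphic.CartanUnique Literature.Combinatorics.SimpleGraph
open Literature.NumberTheory.Automorphic.UnitaryThreeFourFrame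

variable {K : Type*} [Field K] [Valued K ℤᵐ⁰] {σ : K →+* K} {ϖ : K}

-- §2 (tree-ness, ★ `isTree_latticeGraph_three_of_ramified`) lives in the `ValuativeRel` context of ★ `UnitaryLatticeTreeEulerRelationWild`

/-! ## §1 The `U(3)` lattice graph is `(q+1)`-regular at every ramified quadratic datum -/

/-- `|2| = |ϖ|^t` forces `2 ≠ 0` in `K` (the characteristic of `K` is `0` on the wild datum too). [cite: Jacobowitz1962, §9] -/
theorem two_ne_zero_of_v_two_eq_pow (hϖ : Valued.v ϖ = WithZero.exp (-1 : ℤ)) {t : ℕ} (h2t : Valued.v (2 : K) = Valued.v ϖ ^ t) : (2 : K) ≠ 0 := fun h2 => by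
  rw [h2, map_zero] at h2t
  exact pow_ne_zero t (by rw [hϖ]; exact WithZero.coe_ne_zero) h2t.symm

/-- **THE `U(3)` LATTICE GRAPH IS `(q+1)`-REGULAR AT EVERY RAMIFIED QUADRATIC DATUM, WILD ONES INCLUDED**: EVERY vertex — self-dual (★ `ncard_neighborSet_of_isSelfDualLattice_wild`, the root
star) or of type two (★ `ncard_neighborSet_of_isVertexLattice_two_wild`, the type-two star) — has exactly `q + 1` neighbours, `q = |𝓀[K]|`: the local index `(q+1, q+1)` of the ramified
quasi-split `U(3)` (both vertices special). [cite: Tits1979, §2.4] [cite: BruhatTits1972, §10] [cite: Serre1980Trees, II.1.1] -/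
theorem ncard_neighborSet_wild [Finite 𝓀[K]] (hσ : ∀ x, σ (σ x) = x) (hvσ : ∀ a, Valued.v (σ a) = Valued.v a) (hϖ : Valued.v ϖ = WithZero.exp (-1 : ℤ))
    (heven : ∀ x : K, σ x = x → x ≠ 0 → ∃ n : ℤ, Valued.v x = WithZero.exp (2 * n)) {d t : ℕ}
    (hd : Valued.v (ϖ - σ ϖ) = Valued.v ϖ ^ d) (h1d : 1 ≤ d) (h2t : Valued.v (2 : K) = Valued.v ϖ ^ t)
    (v : {M : Submodule 𝒪[K] (Fin 3 → K) // IsVertex σ ϖ ((StdForm.antidiagonal 3).over K) M}) :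
    ((latticeGraph σ ϖ ((StdForm.antidiagonal 3).over K)).neighborSet v).ncard = Nat.card 𝓀[K] + 1 := by
  by_cases hv : IsSelfDualLattice σ ϖ ((StdForm.antidiagonal 3).over K) v.1
  · exact ncard_neighborSet_of_isSelfDualLattice_wild hσ hvσ hϖ heven hd h1d h2t v hv
  · exact ncard_neighborSet_of_isVertexLattice_two_wild hσ hvσ hϖ (fun x hx => v_map_sub_self_lt_one_of_even hσ hϖ heven hd h1d hx) heven
      (two_ne_zero_of_v_two_eq_pow hϖ h2t) v (isVertexLattice_two_of_not_isSelfDualLattice_of_v hvσ hϖ v hv)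

/-- **Every star is finite** at a ramified quadratic datum (finite residue field) — the `hnb` plug of ★ `TreeDisplacementLayerCount` (from the positive count of `ncard_neighborSet_wild`).
[cite: BruhatTits1972, §10] -/
theorem finite_neighborSet_wild [Finite 𝓀[K]] (hσ : ∀ x, σ (σ x) = x) (hvσ : ∀ a, Valued.v (σ a) = Valued.v a) (hϖ : Valued.v ϖ = WithZero.exp (-1 : ℤ))
    (heven : ∀ x : K, σ x = x → x ≠ 0 → ∃ n : ℤ, Valued.v x = WithZero.exp (2 * n)) {d t : ℕ}
    (hd : Valued.v (ϖ - σ ϖ) = Valued.v ϖ ^ d) (h1d : 1 ≤ d) (h2t : Valued.v (2 : K) = Valued.v ϖ ^ t)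
    (v : {M : Submodule 𝒪[K] (Fin 3 → K) // IsVertex σ ϖ ((StdForm.antidiagonal 3).over K) M}) :
    ((latticeGraph σ ϖ ((StdForm.antidiagonal 3).over K)).neighborSet v).Finite :=
  Set.finite_of_ncard_ne_zero (by rw [ncard_neighborSet_wild hσ hvσ hϖ heven hd h1d h2t v]; exact Nat.succ_ne_zero _)

/-- The `hdeg` plug of ★ `TreeDisplacementLayerCount` at a ramified quadratic datum with the CONSTANT valency vector `(q, q)`: `#star(v) = q_{c v} + 1` for any type function `c`.
[cite: Tits1979, §2.4] -/
theorem ncard_neighborSet_eq_typeFun_wild [Finite 𝓀[K]] (hσ : ∀ x, σ (σ x) = x) (hvσ : ∀ a, Valued.v (σ a) = Valued.v a) (hϖ : Valued.v ϖ = WithZero.exp (-1 : ℤ))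
    (heven : ∀ x : K, σ x = x → x ≠ 0 → ∃ n : ℤ, Valued.v x = WithZero.exp (2 * n)) {d t : ℕ}
    (hd : Valued.v (ϖ - σ ϖ) = Valued.v ϖ ^ d) (h1d : 1 ≤ d) (h2t : Valued.v (2 : K) = Valued.v ϖ ^ t)
    (c : {M : Submodule 𝒪[K] (Fin 3 → K) // IsVertex σ ϖ ((StdForm.antidiagonal 3).over K) M} → Fin 2)
    (v : {M : Submodule 𝒪[K] (Fin 3 → K) // IsVertex σ ϖ ((StdForm.antidiagonal 3).over K) M}) :
    ((latticeGraph σ ϖ ((StdForm.antidiagonal 3).over K)).neighborSet v).ncard = (![Nat.card 𝓀[K], Nat.card 𝓀[K]] : Fin 2 → ℕ) (c v) + 1 := by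
  rw [ncard_neighborSet_wild hσ hvσ hϖ heven hd h1d h2t v]
  rcases Fin.exists_fin_two.1 ⟨c v, rfl⟩ with h | h <;> rw [h] <;> rfl

/-! ## §2 The spheres of the `U(3)` tree at every ramified quadratic datum (tree-ness is ★, no binder) -/

/-- **THE SPHERES OF THE `U(3)` TREE AT EVERY RAMIFIED QUADRATIC DATUM, WILD ONES INCLUDED**: for EVERY vertex `r` and `m ≥ 1`, `#{v | dist(r, v) = m} = (q + 1) · q^{m−1}`, `q = |𝓀[K]|`.
Tree-ness is ★ `isTree_latticeGraph_three_of_ramified` (no binder, unlike the tame ★ R4); then ★ `TreeDisplacement.ncard_sphere_eq_of_biregular'` with the constant valency vector `(q, q)`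
and `⌊m∕2⌋ + ⌊(m−1)∕2⌋ = m − 1`. [cite: Serre1980Trees, I.2.3] [cite: Serre1980Trees, II.1.1] [cite: Tits1979, §2.4] -/
theorem ncard_sphere_wild [ValuativeRel K] [(Valued.v : Valuation K ℤᵐ⁰).Compatible] [Finite 𝓀[K]] (hσ : ∀ x, σ (σ x) = x) (hvσ : ∀ a, Valued.v (σ a) = Valued.v a) (hϖ : Valued.v ϖ = WithZero.exp (-1 : ℤ))
    (heven : ∀ x : K, σ x = x → x ≠ 0 → ∃ n : ℤ, Valued.v x = WithZero.exp (2 * n)) {d t : ℕ}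
    (hd : Valued.v (ϖ - σ ϖ) = Valued.v ϖ ^ d) (h1d : 1 ≤ d) (h2t : Valued.v (2 : K) = Valued.v ϖ ^ t)
    (r : {M : Submodule 𝒪[K] (Fin 3 → K) // IsVertex σ ϖ ((StdForm.antidiagonal 3).over K) M}) {m : ℕ} (hm : 1 ≤ m) :
    {v | (latticeGraph σ ϖ ((StdForm.antidiagonal 3).over K)).dist r v = m}.ncard = (Nat.card 𝓀[K] + 1) * Nat.card 𝓀[K] ^ (m - 1) := by
  obtain ⟨c, hc0⟩ := exists_typeFun (K := K) (σ := σ) (ϖ := ϖ)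
  have hab : c r ≠ c r + 1 := by rcases Fin.exists_fin_two.1 ⟨c r, rfl⟩ with h | h <;> rw [h] <;> decide
  have h := TreeDisplacement.ncard_sphere_eq_of_biregular' (isTree_latticeGraph_three_of_ramified hσ hvσ hϖ heven hd h1d h2t)
    (finite_neighborSet_wild hσ hvσ hϖ heven hd h1d h2t) r c (typeFun_ne_of_adj_of_v hvσ hϖ hc0) ![Nat.card 𝓀[K], Nat.card 𝓀[K]]
    (ncard_neighborSet_eq_typeFun_wild hσ hvσ hϖ heven hd h1d h2t c) rfl hab hm
  have hq : ∀ i : Fin 2, (![Nat.card 𝓀[K], Nat.card 𝓀[K]] : Fin 2 → ℕ) i = Nat.card 𝓀[K] := fun i => by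
    rcases Fin.exists_fin_two.1 ⟨i, rfl⟩ with h | h <;> rw [h] <;> rfl
  rw [h, hq, hq, mul_assoc, ← pow_add, show m / 2 + (m - 1) / 2 = m - 1 by omega]

/-- **`q² + q` VERTICES AT DISTANCE `2`** from any vertex, at every ramified quadratic datum. [cite: Serre1980Trees, I.2.3] [cite: Tits1979, §2.4] -/
theorem ncard_sphere_two_wild [ValuativeRel K] [(Valued.v : Valuation K ℤᵐ⁰).Compatible] [Finite 𝓀[K]] (hσ : ∀ x, σ (σ x) = x) (hvσ : ∀ a, Valued.v (σ a) = Valued.v a) (hϖ : Valued.v ϖ = WithZero.exp (-1 : ℤ))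
    (heven : ∀ x : K, σ x = x → x ≠ 0 → ∃ n : ℤ, Valued.v x = WithZero.exp (2 * n)) {d t : ℕ}
    (hd : Valued.v (ϖ - σ ϖ) = Valued.v ϖ ^ d) (h1d : 1 ≤ d) (h2t : Valued.v (2 : K) = Valued.v ϖ ^ t)
    (r : {M : Submodule 𝒪[K] (Fin 3 → K) // IsVertex σ ϖ ((StdForm.antidiagonal 3).over K) M}) :
    {v | (latticeGraph σ ϖ ((StdForm.antidiagonal 3).over K)).dist r v = 2}.ncard = Nat.card 𝓀[K] ^ 2 + Nat.card 𝓀[K] := by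
  rw [ncard_sphere_wild hσ hvσ hϖ heven hd h1d h2t r (by norm_num : 1 ≤ 2)]
  ring

/-! ## §3 Datum-form heads -/

/-- **DATUM-FORM HEAD — the graph is `(q+1)`-regular**: for every `IsRamifiedQuadraticDatum σ ϖ d t` with finite residue field and every vertex `v`, `#star(v) = |𝓀[K]| + 1`.
[cite: Tits1979, §2.4, §2.7] [cite: BruhatTits1972, §10] -/
theorem ncard_neighborSet_of_isRamifiedQuadraticDatum {K : Type} [Field K] [Valued K ℤᵐ⁰] [Finite 𝓀[K]] (σ : K →+* K) (ϖ : K) (d t : ℕ)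
    (hD : IsRamifiedQuadraticDatum σ ϖ d t) (v : {M : Submodule 𝒪[K] (Fin 3 → K) // IsVertex σ ϖ ((StdForm.antidiagonal 3).over K) M}) :
    ((latticeGraph σ ϖ ((StdForm.antidiagonal 3).over K)).neighborSet v).ncard = Nat.card 𝓀[K] + 1 := by
  obtain ⟨hσ, hvσ, hϖ, heven, hd, h1d, h2t⟩ := hD
  exact ncard_neighborSet_wild hσ hvσ hϖ heven hd h1d h2t v

/-- **DATUM-FORM HEAD — the spheres**: for every `IsRamifiedQuadraticDatum σ ϖ d t` with finite residue field, every vertex `r` and `m ≥ 1`, `#{v | dist(r, v) = m} = (q + 1) · q^{m−1}`.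
[cite: Serre1980Trees, I.2.3] [cite: Tits1979, §2.4] -/
theorem ncard_sphere_of_isRamifiedQuadraticDatum {K : Type} [Field K] [Valued K ℤᵐ⁰] [ValuativeRel K] [(Valued.v : Valuation K ℤᵐ⁰).Compatible] [Finite 𝓀[K]] (σ : K →+* K) (ϖ : K) (d t : ℕ)
    (hD : IsRamifiedQuadraticDatum σ ϖ d t) (r : {M : Submodule 𝒪[K] (Fin 3 → K) // IsVertex σ ϖ ((StdForm.antidiagonal 3).over K) M}) {m : ℕ} (hm : 1 ≤ m) :
    {v | (latticeGraph σ ϖ ((StdForm.antidiagonal 3).over K)).dist r v = m}.ncard = (Nat.card 𝓀[K] + 1) * Nat.card 𝓀[K] ^ (m - 1) := by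
  obtain ⟨hσ, hvσ, hϖ, heven, hd, h1d, h2t⟩ := hD
  exact ncard_sphere_wild hσ hvσ hϖ heven hd h1d h2t r hm

end Literature.NumberTheory.Automorphic.UnitaryLatticeTree

end
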